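import Summits.ValiantsHypothesis.ValiantsHypothesis.Theses.FifoMatching
import Literature.Computability.AlgebraicComplexity.NestFreeMatchingPoly

/-!
# Crux `FifoMatching.NNLowDegreeCofactorHard` (stmt-ValiantsHypothesis-22993) — line `freed-vertices` (skeleton)

The crux: for all `d, c` and all large `n`, every nonzero cofactor `h ∈ ℝ≥0[x]` of total degree
`≤ d` leaves `NN_n` quasi-polynomially hard, `2^((log₂ n + c)^c) < L₊(NN_n · h) + L₊(h)`
(`NN_n` = the nest-free (FIFO) perfect-matching polynomial of `[2n]` in the arc variables
`x_(i,j)`, `L₊` = `complexity` over the semiring `ℝ≥0`).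

LEVER: **a cofactor of degree `δ` buys at most `2δ` FREED VERTICES.**  Grade the arc variables by
vertex potentials `x_(i,j) ↦ B^i + B^j` (`B = 2δ + 1`).  `NN_n` is homogeneous for this weight
(every perfect matching touches every vertex once), and the top weighted component of a monotone
circuit is free (`Theorems.ZeroOneTransfer.Negative.complexity_topComponent_le`, landed), so
`L₊(NN_n · top h) ≤ L₊(NN_n · h)`; by base-`B` uniqueness all monomials of `top h` have the same
vertex-degree vector, supported on a vertex set `R`, `|R| ≤ 2δ`, and every variable of `top h`
has both endpoints in `R`.  Freeing `R` (arcs touching `R ↦ 1`, a projection) turns `top h` into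
a positive constant and `NN_n` into `NN_n^R` — this is the vertex analogue of the landed
row-killing theorem for the spanning-tree polynomial
(`Theorems.ZeroOneTransfer.Negative.two_rpow_le_complexity_stPoly_mul`).  Then CARVE: in the
longest run `J` of `[2n] ∖ R` choose an interval `I` (`|I| ≥ |J| - 2`, both outer sides even);
kill the arcs leaving `I` (`↦ 0`), free the arcs outside `I` (`↦ 1`), rename `I ≅ [2n']`, and
take the top-degree component (free again): its support is exactly the set of nest-free perfect
matchings of `[2n']`, `n ≤ (|R|+1)(n'+2)`.  Finally the support-generic, uniform-in-`n` form of
the PROVED monotone bound (`nnMonotoneExpBound_proof`, stmt-22994: `2^{n^{1/6}} ≤ L₊(NN_n)`; the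
thick-queue argument only reads supports) beats every quasi-polynomial in `n ≤ (2d+1)(n'+2)`.

Stubs (registered): `stub_cofactorBuysVertices` (S1, M: top component + freeing, adaptation of
`LowDegreeCofactor.lean` §Rows/§Main (1)–(3) from rows to vertices), `stub_carveInterval`
(S2, M: new nest-free-matching combinatorics + two free operations), `stub_supportGenericQPHard`
(S3, M–L: `FifoMatchingNNMonotoneExpBound.lean` re-run for any `g` with `supp g = supp NN_{n'}`,
plus growth arithmetic `(log₂((r+1)(n'+2)) + c)^c < n'^{1/6}`).  Composition (no sorry outside
the stubs): `NNLowDegreeCofactorHard_of_line`, concluding the crux BY NAME.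
All stub statements are self-contained (Mathlib + `nestFreeMatchingPoly` + `complexity`; no
line-local definitions), so a Theorems file can restate each verbatim and land it `--supports
stmt-ValiantsHypothesis-22993`.
-/

noncomputable section

-- Sub = Summit single-conjunct layout: the duplicated namespace component is mandated by the tree.
set_option linter.dupNamespace false

namespace Summit.ValiantsHypothesis.ValiantsHypothesis.Cruxes.NNLowDegreeCofactorHard.FreedVertices

open MvPolynomial Literature.Computability.AlgebraicComplexity
open scoped NNReal

/-! ### The three registered stubs -/

/-- **S1 — a cofactor of degree `δ` buys at most `2δ` freed vertices.**  For every nonzero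
`h ∈ ℝ≥0[x_(i,j)]` there are a vertex set `R ⊆ [2n]`, `|R| ≤ 2·deg h`, and a polynomial `q` with
the support of `NN_n^R := NN_n[x_e := 1 for every arc e touching R]` and `L₊(q) ≤ L₊(NN_n · h)`.
Intended proof: `q := (NN_n · top_w h)[R := 1] = η · NN_n^R` (`η > 0` the coefficient sum of
`top_w h`) for the vertex-potential weight `w(x_(i,j)) = B^i + B^j`, `B = 2·deg h + 1`: initial
forms are free (`complexity_topComponent_le`), `NN_n` is `w`-homogeneous so
`top_w(NN_n·h) = NN_n·top_w h` (`topComponent_mul`), base-`B` uniqueness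
(`eq_of_sum_mul_pow_eq`) puts all monomials of `top_w h` on one vertex-degree vector with
support `R`, and the substitution is a projection (`complexity_le_of_isProjection`). [folklore] -/
theorem stub_cofactorBuysVertices :
    ∀ (n : ℕ) (h : MvPolynomial (Fin (2 * n) × Fin (2 * n)) ℝ≥0), h ≠ 0 →
      ∃ R : Finset (Fin (2 * n)), R.card ≤ 2 * h.totalDegree ∧
        ∃ q : MvPolynomial (Fin (2 * n) × Fin (2 * n)) ℝ≥0,
          q.support = (MvPolynomial.aeval (fun e : Fin (2 * n) × Fin (2 * n) =>
              if e.1 ∈ R ∨ e.2 ∈ R then (1 : MvPolynomial (Fin (2 * n) × Fin (2 * n)) ℝ≥0)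
              else MvPolynomial.X e) (nestFreeMatchingPoly n ℝ≥0)).support ∧
          complexity q ≤ complexity (nestFreeMatchingPoly n ℝ≥0 * h) := by
  sorry

/-- **S2 — carving an interval.**  For every vertex set `R ⊆ [2n]` and every `q` with the support
of `NN_n^R` there are `n'` with `n ≤ (|R|+1)(n'+2)` and a polynomial `g` in the arc variables of
`[2n']` with EXACTLY the support of `NN_{n'}` and `L₊(g) ≤ L₊(q)`.  Intended proof: `J` = a
longest run of `[2n] ∖ R` (`(|R|+1)|J| ≥ 2n - |R|`); `I ⊆ J` an interval with `|I| ≥ |J| - 2`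
and both outer sides of even size; substitute `0` for the arcs with exactly one endpoint in `I`,
`1` for the arcs with none, rename `I ≅ Fin (2n')` (a projection, free), and take the top-degree
component (free, `complexity_topComponent_le` with weight `1`): a nest-free perfect matching `N`
of `I` extends by consecutive pairs on both sides to a nest-free perfect matching of `[2n]`, so
`x^N` survives with top degree `n'`, and conversely a surviving monomial of degree `n'` is a
perfect nest-free matching of `I`; over `ℝ≥0` supports are all that matters. [folklore] -/
theorem stub_carveInterval :
    ∀ (n : ℕ) (R : Finset (Fin (2 * n))) (q : MvPolynomial (Fin (2 * n) × Fin (2 * n)) ℝ≥0),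
      q.support = (MvPolynomial.aeval (fun e : Fin (2 * n) × Fin (2 * n) =>
          if e.1 ∈ R ∨ e.2 ∈ R then (1 : MvPolynomial (Fin (2 * n) × Fin (2 * n)) ℝ≥0)
          else MvPolynomial.X e) (nestFreeMatchingPoly n ℝ≥0)).support →
      ∃ n' : ℕ, n ≤ (R.card + 1) * (n' + 2) ∧
        ∃ g : MvPolynomial (Fin (2 * n') × Fin (2 * n')) ℝ≥0,
          g.support = (nestFreeMatchingPoly n' ℝ≥0).support ∧ complexity g ≤ complexity q := by
  sorry

/-- **S3 — support-generic, linearly robust quasi-polynomial hardness of `NN`.**  For all `r, c`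
and all large `n`: every `g ∈ ℝ≥0[x]` with exactly the support of `NN_{n'}`, where
`n ≤ (r+1)(n'+2)`, has `L₊(g) > 2^((log₂ n + c)^c)`.  Intended proof: the landed thick-queue
bound `nnMonotoneExpBound_proof` (stmt-22994, `2^{n^{1/6}} ≤ L₊(NN_n)` for `n ≥ n₀`) re-run for
`g` — `exists_balanced_split_of_complexity` uses only homogeneity and the support of `NN_n`, both
determined by `supp g = supp NN_{n'}` — followed by the growth estimate
`(log₂((r+1)(n'+2)) + c)^c < (n')^{1/6}` for large `n'`. [folklore] -/
theorem stub_supportGenericQPHard :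
    ∀ r c : ℕ, ∃ n₀ : ℕ, ∀ n ≥ n₀, ∀ n' : ℕ, n ≤ (r + 1) * (n' + 2) →
      ∀ g : MvPolynomial (Fin (2 * n') × Fin (2 * n')) ℝ≥0,
        g.support = (nestFreeMatchingPoly n' ℝ≥0).support →
          2 ^ ((Nat.log 2 n + c) ^ c) < complexity g := by
  sorry

/-! ### Composition (kernel-checked, no sorry) -/

/-- **The line: `NNLowDegreeCofactorHard` from S1, S2, S3** (applied by name; the route's inlined
`NN_n` is definitionally `nestFreeMatchingPoly n ℝ≥0`).  Given `d, c`, take `n₀` from S3 at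
`r = 2d`; for `n ≥ n₀` and a nonzero cofactor `h` of degree `≤ d`, S1 gives `R` (`|R| ≤ 2d`) and
`q`, S2 gives `n'` with `n ≤ (|R|+1)(n'+2) ≤ (2d+1)(n'+2)` and `g`, and
`2^((log₂ n + c)^c) < L₊(g) ≤ L₊(q) ≤ L₊(NN_n·h) ≤ L₊(NN_n·h) + L₊(h)`. [folklore] -/
theorem NNLowDegreeCofactorHard_of_line :
    Summit.ValiantsHypothesis.ValiantsHypothesis.Theses.FifoMatching.NNLowDegreeCofactorHard := by
  intro d c
  obtain ⟨n₀, hn₀⟩ := stub_supportGenericQPHard (2 * d) c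
  refine ⟨n₀, fun n hn h hh hd => ?_⟩
  obtain ⟨R, hR, q, hq, hqc⟩ := stub_cofactorBuysVertices n h hh
  obtain ⟨n', hn', g, hg, hgc⟩ := stub_carveInterval n R q hq
  have hRd : R.card + 1 ≤ 2 * d + 1 := by omega
  have hle : n ≤ (2 * d + 1) * (n' + 2) := hn'.trans (Nat.mul_le_mul_right _ hRd)
  have hlt := hn₀ n hn n' hle g hg
  show 2 ^ ((Nat.log 2 n + c) ^ c) <
    complexity (nestFreeMatchingPoly n ℝ≥0 * h) + complexity h
  calc 2 ^ ((Nat.log 2 n + c) ^ c) < complexity g := hlt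
    _ ≤ complexity q := hgc
    _ ≤ complexity (nestFreeMatchingPoly n ℝ≥0 * h) := hqc
    _ ≤ complexity (nestFreeMatchingPoly n ℝ≥0 * h) + complexity h := Nat.le_add_right _ _

end Summit.ValiantsHypothesis.ValiantsHypothesis.Cruxes.NNLowDegreeCofactorHard.FreedVertices

end
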